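import Summits.ABC.ABC.Theorems.CuspFieldPencilGoldenFromNFPencil
import Literature.NumberTheory.DiophantineGeometry.MatveevYuPlaceBoundsNumberField
import Literature.NumberTheory.DiophantineGeometry.AbcTwoAdicValuationProofs
import HarnessLib

/-!
# STUB-IDEAS `stub_conjugateCuspTriple` — ideator k=2, GEN 5 (FAMILY 2: RESHAPE) — Sketch

Crux `GoldenCuspShadow` (stmt-ABC-26026), route `CuspFieldPencil`.  `Q = u² − 11uw − w²`,
`R = rad(uwQ)`, `H = max(|u|,|w|)`, `m = min(rad u, rad w)`, `q = rad Q`.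

GEN-5 RESHAPE = STRENGTHEN-TO-SIMPLIFY, twice, on the converged line
`stub ⇐ UWHalf ∧ QSideRadSq` (all three ideators, gen 4):

* **ONE HYPOTHESIS.** `NFPlaceBound K` bundles the tree's PROVED Prop 4.2.4 pair
  (`evertseGyory2022_prop_4_2_4_infinite_nf_of_matveev` / `_finite_nf_of_yu`) into ONE shape
  statement with ONE opaque constant `c ≥ 1` and the clean height factor `∏ max(h(α_k), 1)`;
  `nfPlaceBound_of_matveev_yu` discharges it (constant comparison only).  Every K-lemma below takes
  `(hP : NFPlaceBound K)` and never sees `12(16ed)^{3n+2}(log* d)² m(d)`.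
* **ONE NORM-FORM LEMMA over an ABSTRACT number field.** The K-side datum is stated for ANY number
  field `K`, ANY `β ∈ 𝓞_K` with `β² = sβ − n` (`n ≠ 0`), and the binary form
  `F(u,w) = (u − βw)(u − (s−β)w) = u² − s·uw + n·w²`:  `log H ≤ κ_δ rad(uwF)^δ · rad(F)^{[K:ℚ]}`
  (`NormFormSide`).  No golden numerology (`φ⁵`, `11`, signs), no instance in any statement, no
  splitting law, no conjugation automorphism (`β̄ := s − β`).  Golden stub: `β = θ⁵ = 3 + 5θ`,
  `s = 11`, `n = −1`, `d = 2`; the same lemma serves the route TABLE's other `d = 2` row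
  (Hesse `X(3)`, `ℚ(√−3)`, `F = u² + uw + w²`: `s = −1`, `n = 1`).

Kernel-checked here (rc 0, 5 `sorry`s = exactly H2, H5, H8, H9, H11): **H1 `nfPlaceBound_of_matveev_yu`**
(the ONE hypothesis follows from the two named facts, every `K`), `max_div_le`, H3 `mul_conj_eq_normForm`,
`golden_beta_sq`, `normForm_golden/hesse`, H4 `member_form_w/u`, R0–R3 (`absNorm_span_natCast`,
`exists_prime_over`, `padicValInt_le_ord` ported from k1-g4; `place_cost` for general `d`), **H7
`ord_member`** (the `β̄ := s − β`, `β ∣ n` trick), `min_le_geom`, `stub_of_uwHalf_qSideRadSq`, H12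
`qSideRadSq_of_normFormSide`, `normFormSide_golden`, `stub_of_uwHalf_nfPlaceBound`, `stub_of_facts`.
This seat does not prove the M/S analytic helpers (H2, H5, H8, H9, H11).
-/

noncomputable section

open Real NumberField UniqueFactorizationMonoid Height IsDedekindDomain Finset
open Literature.NumberTheory.DiophantineGeometry.Dioph
open Literature.IUT.LogVolume

namespace Summit.ABC.ABC.Cruxes.GoldenCuspShadow.SideaK2G5

/-! ## §0 Statements (stub verbatim; the two engines' outputs) -/

/-- The registered stub `stub_conjugateCuspTriple`, verbatim. -/
def StubConjugate : Prop :=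
  ∀ ε : ℝ, 0 < ε → ∃ κ : ℝ, ∀ u w : ℤ, IsCoprime u w → u * w * (u ^ 2 - 11 * u * w - w ^ 2) ≠ 0 →
    Real.log (max (|(u : ℝ)|) (|(w : ℝ)|)) ≤
      κ * (((UniqueFactorizationMonoid.radical (u * w * (u ^ 2 - 11 * u * w - w ^ 2))).natAbs : ℕ) : ℝ) ^ (ε : ℝ) *
        ((((UniqueFactorizationMonoid.radical (u ^ 2 - 11 * u * w - w ^ 2)).natAbs : ℕ) : ℝ) ^ (2 / 3 : ℝ) *
          (min (((UniqueFactorizationMonoid.radical u).natAbs : ℕ) : ℝ)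
              (((UniqueFactorizationMonoid.radical w).natAbs : ℕ) : ℝ)) ^ (2 / 3 : ℝ))

/-- ℚ-engine output (UNCONDITIONAL line from `Summit.ABC.ABC.Theorems.approximationBound_rat_holds`;
k1/k2 gen-3 files): `log H ≤ κ_δ R^δ · min(rad u, rad w)`. -/
def UWHalf : Prop :=
  ∀ δ : ℝ, 0 < δ → ∃ κ : ℝ, ∀ u w : ℤ, IsCoprime u w → u * w * (u ^ 2 - 11 * u * w - w ^ 2) ≠ 0 →
    Real.log (max (|(u : ℝ)|) (|(w : ℝ)|)) ≤
      κ * (((radical (u * w * (u ^ 2 - 11 * u * w - w ^ 2))).natAbs : ℕ) : ℝ) ^ (δ : ℝ) *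
        min (((radical u).natAbs : ℕ) : ℝ) (((radical w).natAbs : ℕ) : ℝ)

/-- K-engine output (weak K-datum, all the stub needs): `log H ≤ κ_δ R^δ · rad(Q)²`. -/
def QSideRadSq : Prop :=
  ∀ δ : ℝ, 0 < δ → ∃ κ : ℝ, ∀ u w : ℤ, IsCoprime u w → u * w * (u ^ 2 - 11 * u * w - w ^ 2) ≠ 0 →
    Real.log (max (|(u : ℝ)|) (|(w : ℝ)|)) ≤
      κ * (((radical (u * w * (u ^ 2 - 11 * u * w - w ^ 2))).natAbs : ℕ) : ℝ) ^ (δ : ℝ) *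
        (((radical (u ^ 2 - 11 * u * w - w ^ 2)).natAbs : ℕ) : ℝ) ^ 2

/-! ## §1 ONE HYPOTHESIS: the number-field place bound as a shape statement -/

/-- **H0 `NFPlaceBound K`.** For a number field `K`: ONE constant `c ≥ 1` such that for every
multiplicatively independent-or-not family `α : κ → K×` (`#κ ≥ 2`), exponents `|b_k| ≤ B`, `B ≥ 3`,
`Λ = ∏ α_k^{b_k} − 1 ≠ 0`: at every infinite place `mult(w)·log w(Λ) > −c^{#κ} Ω log B` and at
every prime `log|Λ|_𝔭 > −c^{#κ} (N𝔭/log N𝔭) Ω log B`, with `Ω = ∏ max(logHeight₁ α_k, 1)`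
(Mathlib's `logHeight₁` on `K`, i.e. `d·h`).  This is exactly the SHAPE of EG2022 Prop. 4.2.4; the
unconditional `d = 2` target of the route is `NFPlaceBound (ℚ(√5))`. -/
def NFPlaceBound (K : Type) [Field K] [NumberField K] : Prop :=
  ∃ c : ℝ, 1 ≤ c ∧ ∀ (κ : Type) [Fintype κ], 2 ≤ Fintype.card κ →
    ∀ (α : κ → K) (b : κ → ℤ) (B : ℝ),
      (∀ k, α k ≠ 0) → ∏ k, α k ^ b k - 1 ≠ 0 → 3 ≤ B → (∀ k, (|b k| : ℝ) ≤ B) →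
      (∀ w : InfinitePlace K,
          -(c ^ Fintype.card κ * (∏ k, max (logHeight₁ (α k)) 1) * Real.log B) <
            (w.mult : ℝ) * Real.log (w (∏ k, α k ^ b k - 1))) ∧
      (∀ 𝔭 : HeightOneSpectrum (𝓞 K),
          -(c ^ Fintype.card κ *
              ((Ideal.absNorm 𝔭.asIdeal : ℝ) / Real.log (Ideal.absNorm 𝔭.asIdeal : ℝ)) *
              (∏ k, max (logHeight₁ (α k)) 1) * Real.log B) <
            Real.log (NumberField.HeightOneSpectrum.adicAbv K 𝔭 (∏ k, α k ^ b k - 1)))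

/-- Constant bookkeeping for H1: termwise `max(h/d, m) ≤ max(1,m)·max(h,1)` (`d ≥ 1`, `h ≥ 0`). -/
theorem max_div_le {h d m : ℝ} (hh : 0 ≤ h) (hd : 1 ≤ d) :
    max (h / d) m ≤ max 1 m * max h 1 := by
  have h1 : h / d ≤ h := div_le_self hh hd
  have hM : 1 ≤ max 1 m := le_max_left _ _
  have hX : 1 ≤ max h 1 := le_max_right _ _
  refine max_le ?_ ?_
  · calc h / d ≤ h := h1
      _ ≤ max h 1 := le_max_left _ _
      _ = 1 * max h 1 := (one_mul _).symm
      _ ≤ max 1 m * max h 1 := mul_le_mul_of_nonneg_right hM (by linarith)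
  · calc m ≤ max 1 m := le_max_right _ _
      _ = max 1 m * 1 := (mul_one _).symm
      _ ≤ max 1 m * max h 1 := mul_le_mul_of_nonneg_left hX (by linarith)

/-- **H1 (S).** Matveev-NF ∧ Yu-NF ⇒ `NFPlaceBound K` for every number field `K`, with
`c := 12·(16ed)⁵·max(1,log d)²·(2/log 2)·max(1, m(d))` — the printed `c₁₀(n,d)·(2/log 2)·∏max(h/d,m)`
is `≤ c^n ∏ max(h,1)` factor by factor (`n ≥ 2`). -/
theorem nfPlaceBound_of_matveev_yu (hM : matveev2000_linearFormsLog_nf)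
    (hY : yu2007_padicLogForm_logB_nf) (K : Type) [Field K] [NumberField K] : NFPlaceBound K := by
  classical
  obtain ⟨m, hm⟩ : ∃ m : ℝ, m = (if Module.finrank ℚ K = 1 then Real.log 2
      else 2 / ((Module.finrank ℚ K : ℝ) * Real.log (3 * (Module.finrank ℚ K : ℝ)) ^ 3)) := ⟨_, rfl⟩
  obtain ⟨E, hE⟩ : ∃ E : ℝ, E = 16 * Real.exp 1 * (Module.finrank ℚ K : ℝ) := ⟨_, rfl⟩
  obtain ⟨L, hL⟩ : ∃ L : ℝ, L = max 1 (Real.log (Module.finrank ℚ K)) := ⟨_, rfl⟩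
  have hd1 : (1 : ℝ) ≤ (Module.finrank ℚ K : ℝ) := by exact_mod_cast Module.finrank_pos
  have hE1 : 1 ≤ E := by
    rw [hE]; have := Real.add_one_le_exp (1 : ℝ); nlinarith
  have hL1 : 1 ≤ L := by rw [hL]; exact le_max_left _ _
  have hM1 : (1 : ℝ) ≤ max 1 m := le_max_left _ _
  have hl2 : (1 : ℝ) ≤ 2 / Real.log 2 := by
    rw [le_div_iff₀ (Real.log_pos (by norm_num))]
    have := Real.log_two_lt_d9; linarith
  set c : ℝ := 12 * E ^ 5 * L ^ 2 * (2 / Real.log 2) * max 1 m with hc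
  have hc1 : 1 ≤ c := by
    have h5 : (1 : ℝ) ≤ E ^ 5 := one_le_pow₀ hE1
    have h2 : (1 : ℝ) ≤ L ^ 2 := one_le_pow₀ hL1
    calc (1 : ℝ) ≤ 12 := by norm_num
      _ = 12 * 1 * 1 * 1 * 1 := by ring
      _ ≤ 12 * E ^ 5 * L ^ 2 * (2 / Real.log 2) * max 1 m := by
          gcongr
  refine ⟨c, hc1, ?_⟩
  intro κ _ hκ α b B hα hΛ hB hb
  -- the printed constant is dominated by `c^n`, and the printed `Ω` by `max(1,m)^n · ∏ max(h,1)`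
  have hn1 : Fintype.card κ ≠ 0 := by omega
  have hΩ : (∏ k, max (logHeight₁ (α k) / (Module.finrank ℚ K : ℝ)) m) ≤
      (max 1 m) ^ Fintype.card κ * ∏ k, max (logHeight₁ (α k)) 1 := by
    rw [show (max 1 m) ^ Fintype.card κ = ∏ _k : κ, max 1 m by
        rw [Finset.prod_const, Finset.card_univ], ← Finset.prod_mul_distrib]
    refine Finset.prod_le_prod (fun k _ => ?_) (fun k _ => max_div_le (zero_le_logHeight₁ _) hd1)
    exact le_max_of_le_left (div_nonneg (zero_le_logHeight₁ _) (by linarith))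
  have hΩ0 : 0 ≤ ∏ k, max (logHeight₁ (α k)) 1 :=
    Finset.prod_nonneg fun k _ => (zero_le_one.trans (le_max_right _ _))
  have hdom : 12 * E ^ (3 * Fintype.card κ + 2) * L ^ 2 * (2 / Real.log 2) *
        (∏ k, max (logHeight₁ (α k) / (Module.finrank ℚ K : ℝ)) m) ≤
      c ^ Fintype.card κ * ∏ k, max (logHeight₁ (α k)) 1 := by
    have step1 : 12 * E ^ (3 * Fintype.card κ + 2) * L ^ 2 * (2 / Real.log 2) *
          (∏ k, max (logHeight₁ (α k) / (Module.finrank ℚ K : ℝ)) m) ≤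
        12 * E ^ (3 * Fintype.card κ + 2) * L ^ 2 * (2 / Real.log 2) *
          ((max 1 m) ^ Fintype.card κ * ∏ k, max (logHeight₁ (α k)) 1) :=
      mul_le_mul_of_nonneg_left hΩ (by positivity)
    have step2 : 12 * E ^ (3 * Fintype.card κ + 2) * L ^ 2 * (2 / Real.log 2) *
          (max 1 m) ^ Fintype.card κ ≤ c ^ Fintype.card κ := by
      have e1 : (12 : ℝ) ≤ 12 ^ Fintype.card κ := le_self_pow₀ (by norm_num) hn1
      have e2 : E ^ (3 * Fintype.card κ + 2) ≤ (E ^ 5) ^ Fintype.card κ := by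
        rw [← pow_mul]; exact pow_le_pow_right₀ hE1 (by omega)
      have e3 : L ^ 2 ≤ (L ^ 2) ^ Fintype.card κ := le_self_pow₀ (one_le_pow₀ hL1) hn1
      have e4 : 2 / Real.log 2 ≤ (2 / Real.log 2) ^ Fintype.card κ := le_self_pow₀ hl2 hn1
      have hM0 : 0 ≤ (max 1 m) ^ Fintype.card κ := pow_nonneg (by linarith) _
      calc 12 * E ^ (3 * Fintype.card κ + 2) * L ^ 2 * (2 / Real.log 2) * (max 1 m) ^ Fintype.card κ
          ≤ 12 ^ Fintype.card κ * (E ^ 5) ^ Fintype.card κ * (L ^ 2) ^ Fintype.card κ *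
              (2 / Real.log 2) ^ Fintype.card κ * (max 1 m) ^ Fintype.card κ := by
            gcongr
        _ = c ^ Fintype.card κ := by rw [hc, mul_pow, mul_pow, mul_pow, mul_pow]
    calc _ ≤ _ := step1
      _ = (12 * E ^ (3 * Fintype.card κ + 2) * L ^ 2 * (2 / Real.log 2) * (max 1 m) ^ Fintype.card κ) *
            ∏ k, max (logHeight₁ (α k)) 1 := by ring
      _ ≤ c ^ Fintype.card κ * ∏ k, max (logHeight₁ (α k)) 1 :=
            mul_le_mul_of_nonneg_right step2 hΩ0
  have hlogB : 0 ≤ Real.log B := Real.log_nonneg (by linarith)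
  refine ⟨fun w => ?_, fun 𝔭 => ?_⟩
  · have h0 := evertseGyory2022_prop_4_2_4_infinite_nf_of_matveev hM K w κ hκ α b B hα
      (sub_ne_zero.mp hΛ) hB hb
    rw [← hm, ← hE, ← hL] at h0
    refine lt_of_le_of_lt ?_ h0
    -- drop the `L² ≥ 1`-free comparison: printed ≤ ours
    have h1 : 12 * E ^ (3 * Fintype.card κ + 2) * L ^ 2 * (2 / Real.log 2) *
          (∏ k, max (logHeight₁ (α k) / (Module.finrank ℚ K : ℝ)) m) * Real.log B ≤
        c ^ Fintype.card κ * (∏ k, max (logHeight₁ (α k)) 1) * Real.log B :=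
      mul_le_mul_of_nonneg_right hdom hlogB
    linarith
  · have h0 := evertseGyory2022_prop_4_2_4_finite_nf_of_yu hY K 𝔭 κ hκ α b B hα hΛ hB hb
    rw [← hm, ← hE, ← hL] at h0
    refine lt_of_le_of_lt ?_ h0
    have hN : 0 ≤ (Ideal.absNorm 𝔭.asIdeal : ℝ) / Real.log (Ideal.absNorm 𝔭.asIdeal : ℝ) := by
      have h1 : (1 : ℝ) < (Ideal.absNorm 𝔭.asIdeal : ℝ) := by
        exact_mod_cast NumberField.HeightOneSpectrum.one_lt_absNorm 𝔭
      exact div_nonneg (by linarith) (Real.log_nonneg h1.le)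
    have h1 : 12 * E ^ (3 * Fintype.card κ + 2) * L ^ 2 *
          ((Ideal.absNorm 𝔭.asIdeal : ℝ) / Real.log (Ideal.absNorm 𝔭.asIdeal : ℝ)) *
          (∏ k, max (logHeight₁ (α k) / (Module.finrank ℚ K : ℝ)) m) * Real.log B ≤
        c ^ Fintype.card κ * ((Ideal.absNorm 𝔭.asIdeal : ℝ) / Real.log (Ideal.absNorm 𝔭.asIdeal : ℝ)) *
          (∏ k, max (logHeight₁ (α k)) 1) * Real.log B := by
      -- the finite clause lacks the factor `2/log 2 ≥ 1`; insert it
      have hΩ' : 0 ≤ ∏ k, max (logHeight₁ (α k) / (Module.finrank ℚ K : ℝ)) m :=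
        Finset.prod_nonneg fun k _ =>
          le_max_of_le_left (div_nonneg (zero_le_logHeight₁ _) (by linarith))
      have h2 : 12 * E ^ (3 * Fintype.card κ + 2) * L ^ 2 *
            (∏ k, max (logHeight₁ (α k) / (Module.finrank ℚ K : ℝ)) m) ≤
          c ^ Fintype.card κ * ∏ k, max (logHeight₁ (α k)) 1 := by
        refine le_trans ?_ hdom
        have : 12 * E ^ (3 * Fintype.card κ + 2) * L ^ 2 *
              (∏ k, max (logHeight₁ (α k) / (Module.finrank ℚ K : ℝ)) m) * 1 ≤
            12 * E ^ (3 * Fintype.card κ + 2) * L ^ 2 *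
              (∏ k, max (logHeight₁ (α k) / (Module.finrank ℚ K : ℝ)) m) * (2 / Real.log 2) :=
          mul_le_mul_of_nonneg_left hl2 (by positivity)
        linarith
      have := mul_le_mul_of_nonneg_right (mul_le_mul_of_nonneg_right h2 hN) hlogB
      linarith [this]
    linarith

/-! ## §2 ONE NORM-FORM LEMMA over an abstract number field -/

/-- The binary norm form attached to `β` with `β² = sβ − n`: `F(u,w) = u² − s·uw + n·w²`. -/
def normForm (s n u w : ℤ) : ℤ := u ^ 2 - s * u * w + n * w ^ 2

/-- **`NormFormSide d s n`** (pure-integer statement): `log H ≤ κ_δ rad(uwF)^δ · rad(F)^d` for coprime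
`u, w` with `uwF ≠ 0`, `F = u² − s·uw + n·w²`. -/
def NormFormSide (d : ℕ) (s n : ℤ) : Prop :=
  ∀ δ : ℝ, 0 < δ → ∃ κ : ℝ, ∀ u w : ℤ, IsCoprime u w → u * w * normForm s n u w ≠ 0 →
    Real.log (max (|(u : ℝ)|) (|(w : ℝ)|)) ≤
      κ * (((radical (u * w * normForm s n u w)).natAbs : ℕ) : ℝ) ^ (δ : ℝ) *
        (((radical (normForm s n u w)).natAbs : ℕ) : ℝ) ^ d

/-- **H3 (XS, PROVED).** `(u − βw)(u − (s − β)w) = u² − s·uw + n·w²` whenever `β² = sβ − n`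
(any commutative ring; the "conjugate" is `s − β`, no automorphism needed). -/
theorem mul_conj_eq_normForm {R : Type*} [CommRing R] (β s n u w : R) (hβ : β * β = s * β - n) :
    (u - β * w) * (u - (s - β) * w) = u ^ 2 - s * u * w + n * w ^ 2 := by
  linear_combination (-(w ^ 2)) * hβ

/-- Golden numerology, ONCE: `β = θ⁵ = 3 + 5θ` has `β² = 11β + 1` (`s = 11`, `n = −1`) when
`θ² = θ + 1`; and `u − βw`, `u − (11 − β)w` are the route's forms `u + (−3−5θ)w`, `u + (−8+5θ)w`. -/
theorem golden_beta_sq {R : Type*} [CommRing R] (θ : R) (hθ : θ * θ = θ + 1) :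
    (3 + 5 * θ) * (3 + 5 * θ) = (11 : R) * (3 + 5 * θ) - (-1 : R) := by
  linear_combination (25 : R) * hθ

example {R : Type*} [CommRing R] (θ u w : R) :
    u - (3 + 5 * θ) * w = 1 * u + (-3 - 5 * θ) * w ∧
      u - (11 - (3 + 5 * θ)) * w = 1 * u + (-8 + 5 * θ) * w := by
  constructor <;> ring

/-- The golden norm form is `Q`. -/
theorem normForm_golden (u w : ℤ) : normForm 11 (-1) u w = u ^ 2 - 11 * u * w - w ^ 2 := by
  unfold normForm; ring

/-- Hesse row of the route TABLE (`ℚ(√−3)`, `β = ζ₃`, `β² = −β − 1`): `F = u² + uw + w²`. -/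
theorem normForm_hesse (u w : ℤ) : normForm (-1) 1 u w = u ^ 2 + u * w + w ^ 2 := by
  unfold normForm; ring

/-- **H4 (XS, PROVED).** The member `x = u − βw` as unit-times-Λ-form, both ways:
`x = βw·(u/(βw) − 1)` and `x = −u·(w/(β⁻¹u) − 1)` (the number-field twin of Pasten's two readings). -/
theorem member_form_w {K : Type*} [Field K] (β u w : K) (hβ : β ≠ 0) (hw : w ≠ 0) :
    u - β * w = β * w * (u / (β * w) - 1) := by
  field_simp
theorem member_form_u {K : Type*} [Field K] (β u w : K) (hβ : β ≠ 0) (hu : u ≠ 0) :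
    u - β * w = -u * (w / (β⁻¹ * u) - 1) := by
  have : β⁻¹ * u ≠ 0 := mul_ne_zero (inv_ne_zero hβ) hu
  field_simp
  ring

/-- The LFL error term of a two-integer member: `T(u,v) = A·C^{ω(uv)}·(∏_{p∣uv} log p)·log(2 log H₀ + 3)`. -/
def memberT (A C : ℝ) (u v : ℤ) : ℝ :=
  A * C ^ (u * v).natAbs.primeFactors.card * (∏ p ∈ (u * v).natAbs.primeFactors, Real.log p) *
    Real.log (2 * Real.log (max (|(u : ℝ)|) (|(v : ℝ)|)) + 3)

/-- **H2 `memberBound` (M−, the ONE generator-family instantiation; load-bearing).** For a number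
field `K` with `NFPlaceBound K` and a fixed `α₀ ∈ K×`: uniformly in nonzero integers `u, v` with
`Λ = u/(α₀v) − 1 ≠ 0`, BOTH clauses at once —
arch: `mult(w)·log w(Λ) ≥ −T(u,v)` at every infinite place; finite: `ord_𝔭(Λ)·log N𝔭 ≤ T(u,v)·N𝔭/log N𝔭`
at every prime.  Proof: ONE family `κ = Option (Option ↥(uv).natAbs.primeFactors)`,
`α(p) = (p : K)`, `b(p) = v_p(u) − v_p(v)`; `α = α₀`, `b = −1`; `α = −1`, `b ∈ {0,1}` (sign; pads
`#κ ≥ 2`); `∏ α^b = u/(α₀ v)`; `B = 2 log max(|u|,|v|) + 3 ≥ max(3, |b|)`; heights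
`logHeight₁ ((p:ℚ) ↦ K) = d·log p` (`NumberField.logHeight₁_algebraMap`, HeightsBaseChangeProofs:239,
+ `Pasten.logHeight₁_natCast_prime`), `max(d log p, 1) ≤ (d/log 2)·log p`, `logHeight₁(−1) = 0`;
`A = c²·max(h(α₀),1)`, `C = c·d/log 2`; finite clause via `LogVolume.adicAbv_eq_absNorm_zpow`. -/
theorem memberBound (K : Type) [Field K] [NumberField K] (hP : NFPlaceBound K) (α₀ : K)
    (hα₀ : α₀ ≠ 0) :
    ∃ A C : ℝ, 0 ≤ A ∧ 1 ≤ C ∧ ∀ u v : ℤ, u ≠ 0 → v ≠ 0 → (u : K) / (α₀ * v) - 1 ≠ 0 →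
      (∀ w : InfinitePlace K,
          -memberT A C u v ≤ (w.mult : ℝ) * Real.log (w ((u : K) / (α₀ * v) - 1))) ∧
      (∀ 𝔭 : HeightOneSpectrum (𝓞 K),
          (ord K 𝔭 ((u : K) / (α₀ * v) - 1) : ℝ) * Real.log (Ideal.absNorm 𝔭.asIdeal : ℝ) ≤
            memberT A C u v *
              ((Ideal.absNorm 𝔭.asIdeal : ℝ) / Real.log (Ideal.absNorm 𝔭.asIdeal : ℝ))) := by
  sorry

/-- **H5 `fNotSmall` (S given H2–H4).** Archimedean half, NO trichotomy, NO regime: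
`2 log H ≤ log|F(u,w)| + 2·T(u,w)` (with `T` the max of the four member error terms for
`α₀ ∈ {β, s−β, β⁻¹, (s−β)⁻¹}`).  Proof at any infinite place `w₀`: `w₀(x)·w₀(x̄) = |F|`,
`log w₀(x) = log w₀(β) + log|w| + log w₀(Λ_w) ≥ log|w| + log w₀(β) − T` (H4, H2; `mult ≥ 1` and the
sign trick `y < 0 ⇒ mult·y ≤ y`), same for `x̄` with `w₀(β)w₀(β̄) = |n| ≥ 1`; and the `u`-reading
`x = −uΛ_u` gives `≥ 2 log|u| − 2T`. -/
theorem fNotSmall (K : Type) [Field K] [NumberField K] (hP : NFPlaceBound K) (β : 𝓞 K) (s n : ℤ)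
    (hβ : β * β = (s : 𝓞 K) * β - (n : 𝓞 K)) (hn : n ≠ 0) :
    ∃ A C : ℝ, 0 ≤ A ∧ 1 ≤ C ∧ ∀ u w : ℤ, u ≠ 0 → w ≠ 0 → normForm s n u w ≠ 0 →
      2 * Real.log (max (|(u : ℝ)|) (|(w : ℝ)|)) ≤
        Real.log |((normForm s n u w : ℤ) : ℝ)| + 2 * memberT A C u w := by
  sorry

/-- R0 (k1-g4 F0, PROVED there; ported): `N((p)) = p^{[K:ℚ]}`. [folklore] -/
theorem absNorm_span_natCast (K : Type) [Field K] [NumberField K] (p : ℕ) :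
    Ideal.absNorm (Ideal.span {((p : ℕ) : 𝓞 K)}) = p ^ Module.finrank ℚ K := by
  rw [Ideal.absNorm_span_singleton]
  have h1 : ((p : ℕ) : 𝓞 K) = algebraMap ℤ (𝓞 K) (p : ℤ) := by simp
  rw [h1, Algebra.norm_algebraMap, NumberField.RingOfIntegers.rank]
  simp [Int.natAbs_pow]

/-- **R1 (k1-g4 F1 = k3-g4 V1, PROVED there; ported).** A rational prime lies in some prime of
`𝓞_K` — NO decomposition law. [folklore] -/
theorem exists_prime_over (K : Type) [Field K] [NumberField K] {p : ℕ} (hp : p.Prime) :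
    ∃ 𝔭 : HeightOneSpectrum (𝓞 K), (p : 𝓞 K) ∈ 𝔭.asIdeal := by
  have hne : Ideal.span {((p : ℕ) : 𝓞 K)} ≠ ⊤ := by
    intro h
    have h1 := absNorm_span_natCast K p
    rw [h, Ideal.absNorm_top] at h1
    have hn : 0 < Module.finrank ℚ K := Module.finrank_pos
    have : p ^ Module.finrank ℚ K ≠ 1 := Ne.symm (ne_of_lt (Nat.one_lt_pow hn.ne' hp.one_lt))
    exact this h1.symm
  obtain ⟨M, hM, hle⟩ := Ideal.exists_le_maximal _ hne
  have hp0 : ((p : ℕ) : 𝓞 K) ≠ 0 := by exact_mod_cast hp.ne_zero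
  have hMbot : M ≠ ⊥ := by
    intro hb
    have : ((p : ℕ) : 𝓞 K) ∈ M := hle (Ideal.mem_span_singleton_self _)
    rw [hb, Ideal.mem_bot] at this
    exact hp0 this
  exact ⟨⟨M, hM.isPrime, hMbot⟩, hle (Ideal.mem_span_singleton_self _)⟩

/-- **R2 (k1-g4 F3, PROVED there; ported).** `v_p(z) ≤ ord_𝔭(z)` for `𝔭 ∋ p`, `z ≠ 0`. [folklore] -/
theorem padicValInt_le_ord (K : Type) [Field K] [NumberField K] {p : ℕ} (hp : p.Prime)
    (𝔭 : HeightOneSpectrum (𝓞 K)) (h𝔭 : (p : 𝓞 K) ∈ 𝔭.asIdeal) {z : ℤ} (hz : z ≠ 0) :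
    (padicValInt p z : ℤ) ≤ ord K 𝔭 (z : K) := by
  haveI : Fact p.Prime := ⟨hp⟩
  obtain ⟨z', hz'⟩ := padicValInt_dvd (p := p) z
  set v := padicValInt p z with hv
  have hz'0 : z' ≠ 0 := by
    rintro rfl; simp at hz'; exact hz hz'
  have hp0 : ((p : ℕ) : 𝓞 K) ≠ 0 := by exact_mod_cast hp.ne_zero
  have hpK : (((p : ℕ) : 𝓞 K) : K) = ((p : ℕ) : K) := by simp
  have hz'K : ((z' : 𝓞 K) : K) = ((z' : ℤ) : K) := by simp
  have hpK0 : ((p : ℕ) : K) ≠ 0 := by exact_mod_cast hp.ne_zero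
  have hz'K0 : ((z' : ℤ) : K) ≠ 0 := by exact_mod_cast hz'0
  have hordp : 1 ≤ ord K 𝔭 ((p : ℕ) : K) := by
    have := (ord_pos_iff_mem K 𝔭 ((p : ℕ) : 𝓞 K) hp0).mpr h𝔭
    rw [hpK] at this
    omega
  have hordz' : 0 ≤ ord K 𝔭 ((z' : ℤ) : K) := by
    rw [← hz'K]; exact ord_nonneg_of_isIntegral K 𝔭 (z' : 𝓞 K)
  have hcast : ((z : ℤ) : K) = ((p : ℕ) : K) ^ v * ((z' : ℤ) : K) := by
    rw [hz']; push_cast; ring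
  rw [hcast, ord_mul K 𝔭 (pow_ne_zero _ hpK0) hz'K0, ord_pow]
  nlinarith

/-- **R3 (k1-g4 F0+F2+F5 / k3-g4 V0+V2 at `d = 2`; general `d` PROVED here).** Crude place cost,
NO splitting law: for `𝔭 ∋ p`, `N𝔭 = p^i` with `1 ≤ i ≤ [K:ℚ]`, hence `log p ≤ log N𝔭` and
`N𝔭/log N𝔭 ≤ p^{[K:ℚ]}/log p`. [folklore] -/
theorem place_cost (K : Type) [Field K] [NumberField K] {p : ℕ} (hp : p.Prime)
    (𝔭 : HeightOneSpectrum (𝓞 K)) (h𝔭 : (p : 𝓞 K) ∈ 𝔭.asIdeal) :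
    Real.log p ≤ Real.log (Ideal.absNorm 𝔭.asIdeal : ℝ) ∧
      (Ideal.absNorm 𝔭.asIdeal : ℝ) / Real.log (Ideal.absNorm 𝔭.asIdeal : ℝ) ≤
        (p : ℝ) ^ Module.finrank ℚ K / Real.log p := by
  have hdvd : Ideal.absNorm 𝔭.asIdeal ∣ p ^ Module.finrank ℚ K := by
    rw [← absNorm_span_natCast K p]
    apply Ideal.absNorm_dvd_absNorm_of_le
    rw [Ideal.span_singleton_le_iff_mem]
    exact h𝔭
  obtain ⟨i, hi, hN⟩ := (Nat.dvd_prime_pow hp).mp hdvd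
  have hN1 : (1 : ℕ) < Ideal.absNorm 𝔭.asIdeal := NumberField.HeightOneSpectrum.one_lt_absNorm 𝔭
  have hi0 : i ≠ 0 := by
    rintro rfl; rw [hN, pow_zero] at hN1; exact lt_irrefl _ hN1
  have hp1 : (1 : ℝ) < p := by exact_mod_cast hp.one_lt
  have hp0 : (0 : ℝ) < p := by linarith
  have hlog : 0 < Real.log p := Real.log_pos hp1
  have hNR : (Ideal.absNorm 𝔭.asIdeal : ℝ) = (p : ℝ) ^ i := by rw [hN]; push_cast; rfl
  rw [hNR, Real.log_pow]
  have hi1 : (1 : ℝ) ≤ i := by exact_mod_cast Nat.one_le_iff_ne_zero.mpr hi0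
  refine ⟨?_, ?_⟩
  · calc Real.log p = 1 * Real.log p := (one_mul _).symm
      _ ≤ (i : ℝ) * Real.log p := mul_le_mul_of_nonneg_right hi1 hlog.le
  · have hpow : (p : ℝ) ^ i ≤ (p : ℝ) ^ Module.finrank ℚ K := pow_le_pow_right₀ hp1.le hi
    calc (p : ℝ) ^ i / ((i : ℝ) * Real.log p) ≤ (p : ℝ) ^ i / Real.log p := by
          apply div_le_div_of_nonneg_left (by positivity) hlog
          calc Real.log p = 1 * Real.log p := (one_mul _).symm
            _ ≤ (i : ℝ) * Real.log p := mul_le_mul_of_nonneg_right hi1 hlog.le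
      _ ≤ (p : ℝ) ^ Module.finrank ℚ K / Real.log p := div_le_div_of_nonneg_right hpow hlog.le

/-- **H7 `ord_member` (S).** At a prime `𝔭` not dividing `w`: `ord_𝔭(u − βw) = ord_𝔭(β) + ord_𝔭(Λ_w)`
(H4 + `ord_mul`), and `0 ≤ ord_𝔭(β) ≤ ord_𝔭(n)` (`β ∣ n` in `𝓞_K` since `β(s − β) = n`;
`ord_nonneg_of_isIntegral`).  (At `p ∣ F`, `p ∤ w` is automatic: `F ≡ u² (mod w)`.) -/
theorem ord_member (K : Type) [Field K] [NumberField K] (β : 𝓞 K) (s n : ℤ)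
    (hβ : β * β = (s : 𝓞 K) * β - (n : 𝓞 K)) (hn : n ≠ 0) (𝔭 : HeightOneSpectrum (𝓞 K))
    {u w : ℤ} (hw : w ≠ 0) (hw𝔭 : ord K 𝔭 (w : K) = 0) (hx : (u : K) - (β : K) * w ≠ 0) :
    ord K 𝔭 ((u : K) - (β : K) * w) = ord K 𝔭 (β : K) + ord K 𝔭 ((u : K) / ((β : K) * w) - 1) ∧
      0 ≤ ord K 𝔭 (β : K) ∧ ord K 𝔭 (β : K) ≤ ord K 𝔭 (n : K) := by
  -- `β · (s − β) = n` in `𝓞 K`, hence in `K`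
  have hprod : β * ((s : 𝓞 K) - β) = (n : 𝓞 K) := by
    linear_combination (-1 : 𝓞 K) * hβ
  have hn' : (n : 𝓞 K) ≠ 0 := by exact_mod_cast hn
  have hβ0 : β ≠ 0 := by
    intro h; rw [h, zero_mul] at hprod; exact hn' hprod.symm
  have hβ'0 : (s : 𝓞 K) - β ≠ 0 := by
    intro h; rw [h, mul_zero] at hprod; exact hn' hprod.symm
  have hβK : (β : K) ≠ 0 := by exact_mod_cast hβ0
  have hβ'K : (((s : 𝓞 K) - β : 𝓞 K) : K) ≠ 0 := by exact_mod_cast hβ'0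
  have hwK : (w : K) ≠ 0 := by exact_mod_cast hw
  have hprodK : (β : K) * (((s : 𝓞 K) - β : 𝓞 K) : K) = (n : K) := by
    have := congrArg (fun t : 𝓞 K => (t : K)) hprod
    simpa using this
  refine ⟨?_, ord_nonneg_of_isIntegral K 𝔭 β, ?_⟩
  · have hform := member_form_w (β : K) (u : K) (w : K) hβK hwK
    have hΛ : (u : K) / ((β : K) * w) - 1 ≠ 0 := by
      intro h; rw [hform, h, mul_zero] at hx; exact hx rfl
    rw [hform, ord_mul K 𝔭 (mul_ne_zero hβK hwK) hΛ, ord_mul K 𝔭 hβK hwK, hw𝔭]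
    ring
  · rw [← hprodK, ord_mul K 𝔭 hβK hβ'K]
    have := ord_nonneg_of_isIntegral K 𝔭 ((s : 𝓞 K) - β)
    linarith

/-- **H8 `fUpper` (S given H2, R1–R3, H7).** Non-archimedean half with the CRUDE cost:
`log|F| ≤ C₀ + (2/log 2)·T(u,w)·rad(F)^{[K:ℚ]}`.  Proof: `log|F| = Σ_{p∣F} v_p(F) log p`
(`Nat.log_eq_sum_factorization`-shape); per `p ∣ F` pick `𝔭 ∋ p` (R1); `v_p(F) log p ≤ ord_𝔭(F)·log N𝔭
= (ord_𝔭 x + ord_𝔭 x̄)·log N𝔭` (R2, R3, `ord_mul`, H3) `≤ 2·ord_𝔭(n) log N𝔭 + 2T·N𝔭/log N𝔭` (H7, H2 with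
`α₀ = β`, `s − β`; `p ∤ w`) `≤ 2d·v_p(n)·d log p + 2T p^d/log p`; sum: `Σ_{p∣F} p^d/log p ≤ rad(F)^d/log 2`
(k1 F6 `Σ ≤ ∏` for terms `≥ 2`), `C₀ = 2d² log|n|`. -/
theorem fUpper (K : Type) [Field K] [NumberField K] (hP : NFPlaceBound K) (β : 𝓞 K) (s n : ℤ)
    (hβ : β * β = (s : 𝓞 K) * β - (n : 𝓞 K)) (hn : n ≠ 0) :
    ∃ A C C₀ : ℝ, 0 ≤ A ∧ 1 ≤ C ∧ ∀ u w : ℤ, IsCoprime u w → u * w * normForm s n u w ≠ 0 →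
      Real.log |((normForm s n u w : ℤ) : ℝ)| ≤
        C₀ + 2 / Real.log 2 * memberT A C u w *
          (((radical (normForm s n u w)).natAbs : ℕ) : ℝ) ^ Module.finrank ℚ K := by
  sorry

/-- **H9 `endgame` (S; = k2-g4 E1 = k3 A2 = k1 bootstrap, reuse whichever lands).**
`X ≤ M·log(2X + 3) + C₀`, `M ≥ 1` ⇒ `X ≤ κ_η M^{1+η}`. -/
theorem endgame (η C₀ : ℝ) (hη : 0 < η) :
    ∃ κ : ℝ, ∀ X M : ℝ, 0 ≤ X → 1 ≤ M → X ≤ M * Real.log (2 * X + 3) + C₀ →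
      X ≤ κ * M ^ (1 + η : ℝ) := by
  sorry

/-- H10 absorption = TREE lemmas, by name (AbcTwoAdicValuationProofs:109/127); sanity that they are
in scope with the expected shape. -/
example {C : ℝ} (hC : 1 ≤ C) {δ : ℝ} (hδ : 0 < δ) :
    ∃ C' : ℝ, 1 ≤ C' ∧ ∀ n : ℕ, C ^ n.primeFactors.card ≤ C' * (∏ p ∈ n.primeFactors, (p : ℝ)) ^ δ :=
  Literature.NumberTheory.DiophantineGeometry.exists_pow_card_primeFactors_le_mul_rpow hC hδ
example {δ : ℝ} (hδ : 0 < δ) :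
    ∃ C' : ℝ, 1 ≤ C' ∧ ∀ n : ℕ, (∏ p ∈ n.primeFactors, Real.log p) ≤
      C' * (∏ p ∈ n.primeFactors, (p : ℝ)) ^ δ :=
  Literature.NumberTheory.DiophantineGeometry.exists_prod_log_primeFactors_le_mul_rpow hδ

/-- **H11 `normFormSide_of_nfPlaceBound` (S assembly of H5, H8, H9, H10).**
`2 log H ≤ C₀ + T·(2 + (2/log 2) rad(F)^d)` ⇒ (H9 with `M = Θ(uw)·rad(F)^d·const`, `η = δ/(2d+2)`)
`log H ≤ κ M^{1+η}` ⇒ (H10 twice at `δ' = δ/4`, `rad(F)^{dη} ≤ R^{δ/2}`, `rad(uw), rad(F) ≤ R`)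
`log H ≤ κ_δ R^δ rad(F)^d`. -/
theorem normFormSide_of_nfPlaceBound (K : Type) [Field K] [NumberField K] (hP : NFPlaceBound K)
    (β : 𝓞 K) (s n : ℤ) (hβ : β * β = (s : 𝓞 K) * β - (n : 𝓞 K)) (hn : n ≠ 0) :
    NormFormSide (Module.finrank ℚ K) s n := by
  sorry

/-! ## §3 Kernel-checked compositions -/

/-- `min a b ≤ a^s b^t` for `s + t = 1`, `s, t ≥ 0`, `a, b ≥ 0` (k2-g4, PROVED). -/
theorem min_le_geom {a b s t : ℝ} (ha : 0 ≤ a) (hb : 0 ≤ b) (hs : 0 ≤ s) (ht : 0 ≤ t)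
    (hst : s + t = 1) : min a b ≤ a ^ s * b ^ t := by
  have hm0 : 0 ≤ min a b := le_min ha hb
  have hsplit : min a b = (min a b) ^ s * (min a b) ^ t := by
    rw [← Real.rpow_add' hm0 (by rw [hst]; norm_num), hst, Real.rpow_one]
  rw [hsplit]
  exact mul_le_mul (Real.rpow_le_rpow hm0 (min_le_left a b) hs)
    (Real.rpow_le_rpow hm0 (min_le_right a b) ht) (Real.rpow_nonneg hm0 t) (Real.rpow_nonneg ha s)

/-- **The cover step (k1/k2/k3 gen 4, PROVED): `UWHalf ∧ QSideRadSq ⇒ stub`** via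
`min(m, q²) ≤ m^{2/3} (q²)^{1/3}`. -/
theorem stub_of_uwHalf_qSideRadSq (h1 : UWHalf) (h2 : QSideRadSq) : StubConjugate := by
  intro ε hε
  obtain ⟨κ₁, hκ₁⟩ := h1 ε hε
  obtain ⟨κ₂, hκ₂⟩ := h2 ε hε
  refine ⟨max (max κ₁ κ₂) 0, fun u w huw h0 => ?_⟩
  have hA := hκ₁ u w huw h0
  have hB := hκ₂ u w huw h0
  generalize hR : (((radical (u * w * (u ^ 2 - 11 * u * w - w ^ 2))).natAbs : ℕ) : ℝ) = R at *
  generalize hq : (((radical (u ^ 2 - 11 * u * w - w ^ 2)).natAbs : ℕ) : ℝ) = q at *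
  generalize ha : (((radical u).natAbs : ℕ) : ℝ) = a at *
  generalize hb : (((radical w).natAbs : ℕ) : ℝ) = b at *
  generalize hL : Real.log (max (|(u : ℝ)|) (|(w : ℝ)|)) = L at *
  have hR0 : 0 ≤ R := by rw [← hR]; exact Nat.cast_nonneg _
  have hq0 : 0 ≤ q := by rw [← hq]; exact Nat.cast_nonneg _
  have ha0 : 0 ≤ a := by rw [← ha]; exact Nat.cast_nonneg _
  have hb0 : 0 ≤ b := by rw [← hb]; exact Nat.cast_nonneg _
  have hm0 : 0 ≤ min a b := le_min ha0 hb0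
  have hRe : 0 ≤ R ^ (ε : ℝ) := Real.rpow_nonneg hR0 _
  set κ : ℝ := max (max κ₁ κ₂) 0 with hκ
  have hκ0 : 0 ≤ κ := le_max_right _ _
  have hκR : 0 ≤ κ * R ^ (ε : ℝ) := mul_nonneg hκ0 hRe
  have hA' : L ≤ κ * R ^ (ε : ℝ) * min a b :=
    hA.trans (mul_le_mul_of_nonneg_right
      (mul_le_mul_of_nonneg_right ((le_max_left κ₁ κ₂).trans (le_max_left (max κ₁ κ₂) 0)) hRe) hm0)
  have hB' : L ≤ κ * R ^ (ε : ℝ) * q ^ 2 :=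
    hB.trans (mul_le_mul_of_nonneg_right
      (mul_le_mul_of_nonneg_right ((le_max_right κ₁ κ₂).trans (le_max_left (max κ₁ κ₂) 0)) hRe) (by positivity))
  have hmin : L ≤ κ * R ^ (ε : ℝ) * min (min a b) (q ^ 2) := by
    rcases le_total (min a b) (q ^ 2) with h | h
    · rw [min_eq_left h]; exact hA'
    · rw [min_eq_right h]; exact hB'
  have hgeom : min (min a b) (q ^ 2) ≤ (min a b) ^ (2 / 3 : ℝ) * (q ^ 2) ^ (1 / 3 : ℝ) :=
    min_le_geom hm0 (by positivity) (by norm_num) (by norm_num) (by norm_num)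
  have hq23 : (q ^ 2) ^ (1 / 3 : ℝ) = q ^ (2 / 3 : ℝ) := by
    rw [show q ^ 2 = q ^ (2 : ℝ) by norm_cast, ← Real.rpow_mul hq0]; norm_num
  calc L ≤ κ * R ^ (ε : ℝ) * min (min a b) (q ^ 2) := hmin
    _ ≤ κ * R ^ (ε : ℝ) * ((min a b) ^ (2 / 3 : ℝ) * (q ^ 2) ^ (1 / 3 : ℝ)) :=
        mul_le_mul_of_nonneg_left hgeom hκR
    _ = κ * R ^ (ε : ℝ) * (q ^ (2 / 3 : ℝ) * (min a b) ^ (2 / 3 : ℝ)) := by rw [hq23]; ring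

/-- **H12 (XS, PROVED).** The golden instance of the pure-integer statement is `QSideRadSq`. -/
theorem qSideRadSq_of_normFormSide (h : NormFormSide 2 11 (-1)) : QSideRadSq := by
  intro δ hδ
  obtain ⟨κ, hκ⟩ := h δ hδ
  refine ⟨κ, fun u w huw h0 => ?_⟩
  have h0' : u * w * normForm 11 (-1) u w ≠ 0 := by rwa [normForm_golden]
  have := hκ u w huw h0'
  simpa only [normForm_golden] using this

/-- **The golden K-side from the ONE hypothesis (PROVED modulo H11):** instantiate the abstract
norm-form lemma at `K = ℚ(√5) = QuadraticAlgebra ℚ 1 1`, `β = 3 + 5θ` (`θ = ω`), `s = 11`, `n = −1`,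
`[K:ℚ] = 2` (`GoldenField.finrank_eq_two`).  The hypothesis is consumed in its universally
quantified form, so NO instance appears in the statement. -/
theorem normFormSide_golden (hP : ∀ (K : Type) [Field K] [NumberField K], NFPlaceBound K) :
    NormFormSide 2 11 (-1) := by
  haveI hfact : Fact (∀ r : ℚ, r ^ 2 ≠ (1 : ℚ) + 1 * r) :=
    ⟨Summit.ABC.ABC.Theorems.GoldenField.golden_fact⟩
  haveI : NumberField (QuadraticAlgebra ℚ (1 : ℚ) 1) :=
    Summit.ABC.ABC.Theorems.GoldenField.numberField
  obtain ⟨θ, hθdef⟩ : ∃ θ : 𝓞 (QuadraticAlgebra ℚ (1 : ℚ) 1),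
      θ = ⟨QuadraticAlgebra.omega, Summit.ABC.ABC.Theorems.GoldenField.isIntegral_omega⟩ := ⟨_, rfl⟩
  have hθ : θ * θ = θ + 1 := by
    rw [hθdef]; exact Summit.ABC.ABC.Theorems.GoldenFromNFPencil.theta_mul_theta
  have hβ : (3 + 5 * θ) * (3 + 5 * θ) =
      ((11 : ℤ) : 𝓞 (QuadraticAlgebra ℚ (1 : ℚ) 1)) * (3 + 5 * θ) -
        ((-1 : ℤ) : 𝓞 (QuadraticAlgebra ℚ (1 : ℚ) 1)) := by
    push_cast; exact golden_beta_sq θ hθ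
  have h := normFormSide_of_nfPlaceBound (QuadraticAlgebra ℚ (1 : ℚ) 1) (hP _) (3 + 5 * θ) 11 (-1)
    hβ (by norm_num)
  have hfin : Module.finrank ℚ (QuadraticAlgebra ℚ (1 : ℚ) 1) = 2 :=
    Summit.ABC.ABC.Theorems.GoldenField.finrank_eq_two
  rwa [hfin] at h

/-- **Stub from the two engines' inputs (PROVED modulo H11).** -/
theorem stub_of_uwHalf_nfPlaceBound (h0 : UWHalf)
    (hP : ∀ (K : Type) [Field K] [NumberField K], NFPlaceBound K) : StubConjugate :=
  stub_of_uwHalf_qSideRadSq h0 (qSideRadSq_of_normFormSide (normFormSide_golden hP))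

/-- **The PROVED-MOD-FACTS shape the lead should land** (`UWHalf` is unconditional in the tree line). -/
theorem stub_of_facts (h0 : UWHalf) (hM : matveev2000_linearFormsLog_nf)
    (hY : yu2007_padicLogForm_logB_nf) : StubConjugate :=
  stub_of_uwHalf_nfPlaceBound h0 (fun K _ _ => nfPlaceBound_of_matveev_yu hM hY K)

end Summit.ABC.ABC.Cruxes.GoldenCuspShadow.SideaK2G5

end
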